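import Summits.SmoothPoincare4.SmoothPoincare4.Theorems.ConvexBisectionAcyclicBisectionExistsChartedChainScale
import HarnessLib

/-!
# The Joukowski branch on the unit circle: the chord, and which sheet is which
(wave 4, brick Y4-3b of the model chain (R2) `exists_charted_chain` for the missing lemma
`crossingNumber_eq_stdSymp` of node N1a of stub `stub_modelsOnFibred_of_reach` = NF4, line
`modp-braid-orbits`, crux `ConvexBisection.AcyclicBisectionExists`, item stmt-SmoothPoincare4-10508;
registered sub-goal `helper_jY_exp_eq`)

On the unit circle `t = e^{iθ}` the Joukowski coordinate `jX` of `…ChartedChainBranch.lean` traces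
the chord `[η̄, η]` twice, `jX (e^{iθ}) = m + iσ cos θ`, and the sheet is
`jY (e^{iθ}) = −σ sin θ · bS (m + iσ cos θ)`.  The chain loops of `LefschetzBasePages.lean` use the
PRINCIPAL root `±√(x^{2g+1} + 1)` instead; this file identifies the two:

  **`jY (e^{iθ}) = −√(jX(e^{iθ})^{2g+1} + 1)` for `θ ∈ [0, π]`** (the lower sheet) and
  `= +√(…)` for `θ ∈ [π, 2π]` (`helper_jY_exp_eq`, `jY_exp_of_mem_Icc'`).

Proof: both sides are continuous square roots of the same function of `θ` on the connected
interval `(0, π)`, where the radicand does not vanish (`‖x‖ < 1` on the open chord, so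
`x^{2g+1} ≠ −1`), and they agree at `θ = π/2` — the midpoint `x = m` of the chord, where
everything is REAL and positive (`bS_ofReal`, `csqrt_ofReal`); hence they agree on `(0, π)`
(`IsPreconnected.eq_of_sq_eq`) and, by evaluation at the branch points `η`, `η̄`, on `[0, π]`.
On the IMAGINARY axis `t = iρ` (`1 ≤ ρ ≤ 1 + 1/(2g+1)`) everything is real and no continuity
argument is needed: `jY (iρ) = −√(jX(iρ)^{2g+1} + 1)` (`jY_I_mul_eq_neg_csqrt`, §3).
Everything is proved; no `sorry`.  References: J. Milnor, *Singular points of complex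
hypersurfaces* (1968), §9 [Milnor1968].
-/

noncomputable section

set_option linter.dupNamespace false

open scoped Manifold ContDiff Topology ComplexConjugate Real
open Set Function Metric Complex
open Literature.Topology.FourManifolds Literature.Topology.FourManifolds.LefschetzBase

namespace Summit.SmoothPoincare4.SmoothPoincare4.Theorems.AcyclicBisectionExists.ModpBraidOrbits

variable {g : ℕ}

/-! ## §1 Values on the unit circle -/

/-- `e^{iθ} = cos θ + i sin θ` and `(e^{iθ})⁻¹ = cos θ − i sin θ`. [folklore] -/
theorem exp_mul_I_and_inv (θ : ℝ) :
    Complex.exp (θ * I) = (Real.cos θ : ℂ) + (Real.sin θ : ℂ) * I ∧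
      (Complex.exp (θ * I))⁻¹ = (Real.cos θ : ℂ) - (Real.sin θ : ℂ) * I := by
  refine ⟨?_, ?_⟩
  · rw [Complex.exp_mul_I, Complex.ofReal_cos, Complex.ofReal_sin]
  · rw [← Complex.exp_neg, show -((θ : ℂ) * I) = ((-θ : ℝ) : ℂ) * I by push_cast; ring,
      Complex.exp_mul_I, ← Complex.ofReal_cos, ← Complex.ofReal_sin, Real.cos_neg, Real.sin_neg]
    push_cast
    ring

/-- `jX` on the unit circle: `jX (e^{iθ}) = m + iσ cos θ` — the chord. [folklore] -/
theorem jX_exp (g : ℕ) (θ : ℝ) :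
    jX g (Complex.exp (θ * I)) = (cmid g : ℂ) + ((shalf g * Real.cos θ : ℝ) : ℂ) * I := by
  obtain ⟨h1, h2⟩ := exp_mul_I_and_inv θ
  rw [jX, h2, h1]
  push_cast
  ring

/-- `jY` on the unit circle: `jY (e^{iθ}) = −σ sin θ · bS (jX (e^{iθ}))`. [folklore] -/
theorem jY_exp (g : ℕ) (θ : ℝ) :
    jY g (Complex.exp (θ * I)) =
      -((shalf g * Real.sin θ : ℝ) : ℂ) * bS g (jX g (Complex.exp (θ * I))) := by
  obtain ⟨h1, h2⟩ := exp_mul_I_and_inv θ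
  rw [jY]
  congr 1
  rw [h2, h1, Complex.ofReal_mul]
  linear_combination ((shalf g : ℂ) * (Real.sin θ : ℂ)) * Complex.I_sq

/-- The branch point `η = e^{iπ/(2g+1)} = m + iσ`. [folklore] -/
theorem branchPt_zero_eq (g : ℕ) : branchPt g 0 = (cmid g : ℂ) + (shalf g : ℂ) * I := by
  rw [branchPt, (exp_mul_I_and_inv _).1, cmid, shalf]

/-- The real part of the chord point is `m`. [folklore] -/
theorem jX_exp_re (g : ℕ) (θ : ℝ) : (jX g (Complex.exp (θ * I))).re = cmid g := by
  rw [jX_exp]; simp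

/-- The chord point has norm `≤ 1` (`m² + σ² cos² θ ≤ 1`). [folklore] -/
theorem norm_jX_exp_sq (g : ℕ) (θ : ℝ) :
    ‖jX g (Complex.exp (θ * I))‖ ^ 2 = cmid g ^ 2 + shalf g ^ 2 * Real.cos θ ^ 2 := by
  rw [jX_exp, Complex.sq_norm, Complex.normSq_add_mul_I]; ring

/-- The chord point has norm `≤ 1`. [folklore] -/
theorem norm_jX_exp_le (g : ℕ) (θ : ℝ) : ‖jX g (Complex.exp (θ * I))‖ ≤ 1 := by
  have h := norm_jX_exp_sq g θ
  have h1 := cmid_sq_add_shalf_sq g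
  have h2 : Real.cos θ ^ 2 ≤ 1 := by nlinarith [Real.cos_sq_add_sin_sq θ, sq_nonneg (Real.sin θ)]
  have : ‖jX g (Complex.exp (θ * I))‖ ^ 2 ≤ 1 := by nlinarith [sq_nonneg (shalf g)]
  nlinarith [norm_nonneg (jX g (Complex.exp (θ * I)))]

/-- On the OPEN chord (`0 < θ < π`, `g ≥ 1`) the norm is `< 1`. [folklore] -/
theorem norm_jX_exp_lt (hg : 1 ≤ g) {θ : ℝ} (hθ : θ ∈ Ioo 0 π) : ‖jX g (Complex.exp (θ * I))‖ < 1 := by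
  have h := norm_jX_exp_sq g θ
  have h1 := cmid_sq_add_shalf_sq g
  have hs : 0 < Real.sin θ := Real.sin_pos_of_pos_of_lt_pi hθ.1 hθ.2
  have h2 : Real.cos θ ^ 2 < 1 := by nlinarith [Real.cos_sq_add_sin_sq θ]
  have : ‖jX g (Complex.exp (θ * I))‖ ^ 2 < 1 := by
    nlinarith [mul_pos (pow_pos (shalf_pos hg) 2) (sub_pos.2 h2)]
  nlinarith [norm_nonneg (jX g (Complex.exp (θ * I)))]

/-- Inside the open unit disc `x^{2g+1} + 1 ≠ 0`. [folklore] -/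
theorem pow_add_one_ne_zero_of_norm_lt {x : ℂ} (hx : ‖x‖ < 1) : x ^ (2 * g + 1) + 1 ≠ 0 := fun h => by
  have h1 : ‖x ^ (2 * g + 1)‖ = 1 := by
    rw [eq_neg_of_add_eq_zero_left h, norm_neg, norm_one]
  rw [norm_pow] at h1
  have : ‖x‖ ^ (2 * g + 1) < 1 := pow_lt_one₀ (norm_nonneg _) hx (Nat.succ_ne_zero _)
  linarith

/-! ## §2 Which sheet: the sign of the branch along the chord -/

/-- The square identity `(σ sin θ · bS)² = jX^{2g+1} + 1` on the unit circle. [folklore] -/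
theorem sheet_sq_exp (hg : 1 ≤ g) (θ : ℝ) :
    (((shalf g * Real.sin θ : ℝ) : ℂ) * bS g (jX g (Complex.exp (θ * I)))) ^ 2 =
      jX g (Complex.exp (θ * I)) ^ (2 * g + 1) + 1 := by
  rw [← jY_sq hg (Complex.exp_ne_zero _), jY_exp]; ring

/-- Continuity of `θ ↦ σ sin θ · bS (jX e^{iθ})` (the chord lies in the strip). [folklore] -/
theorem continuous_sheet_exp (hg : 1 ≤ g) :
    Continuous fun θ : ℝ => ((shalf g * Real.sin θ : ℝ) : ℂ) * bS g (jX g (Complex.exp (θ * I))) := by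
  have he : Continuous fun θ : ℝ => Complex.exp (θ * I) := by fun_prop
  refine (Complex.continuous_ofReal.comp (continuous_const.mul Real.continuous_sin)).mul ?_
  refine continuous_iff_continuousAt.2 fun θ => ?_
  have h1 : ContinuousAt (fun θ : ℝ => jX g (Complex.exp (θ * I))) θ :=
    ContinuousAt.comp (f := fun θ : ℝ => Complex.exp (θ * I)) (continuousAt_jX g (Complex.exp_ne_zero _))
      he.continuousAt
  exact ContinuousAt.comp (f := fun θ : ℝ => jX g (Complex.exp (θ * I)))
    (continuousAt_bS (by rw [jX_exp_re]; exact cos_branchAngle_one_lt_cmid hg)) h1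

/-- Continuity of `θ ↦ √(jX(e^{iθ})^{2g+1} + 1)` (non-negative real part on the closed disc).
[folklore] -/
theorem continuous_csqrt_exp (g : ℕ) :
    Continuous fun θ : ℝ => csqrt (jX g (Complex.exp (θ * I)) ^ (2 * g + 1) + 1) := by
  have he : Continuous fun θ : ℝ => Complex.exp (θ * I) := by fun_prop
  refine continuous_iff_continuousAt.2 fun θ => ?_
  have h0 : ContinuousAt (fun θ : ℝ => jX g (Complex.exp (θ * I))) θ :=
    ContinuousAt.comp (f := fun θ : ℝ => Complex.exp (θ * I)) (continuousAt_jX g (Complex.exp_ne_zero _))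
      he.continuousAt
  have h1 : ContinuousAt (fun θ : ℝ => jX g (Complex.exp (θ * I)) ^ (2 * g + 1) + 1) θ :=
    (h0.pow _).add continuousAt_const
  exact ContinuousAt.comp (f := fun θ : ℝ => jX g (Complex.exp (θ * I)) ^ (2 * g + 1) + 1)
    (continuousAt_csqrt (re_pow_add_one_nonneg g (norm_jX_exp_le g θ))) h1

/-- At the midpoint `θ = π/2` both roots are the positive real `√(m^{2g+1} + 1)`. [folklore] -/
theorem sheet_eq_csqrt_half (hg : 1 ≤ g) :
    ((shalf g * Real.sin (π / 2) : ℝ) : ℂ) * bS g (jX g (Complex.exp ((π / 2 : ℝ) * I))) =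
      csqrt (jX g (Complex.exp ((π / 2 : ℝ) * I)) ^ (2 * g + 1) + 1) := by
  have hx : jX g (Complex.exp ((π / 2 : ℝ) * I)) = (cmid g : ℂ) := by
    rw [jX_exp, Real.cos_pi_div_two]; simp
  have hsq := sheet_sq_exp hg (π / 2)
  rw [hx] at hsq ⊢
  obtain ⟨r, hr, hbS⟩ := bS_ofReal (g := g) (cos_branchAngle_one_lt_cmid hg)
  rw [hbS, Real.sin_pi_div_two, mul_one] at hsq ⊢
  have hm : 0 ≤ cmid g ^ (2 * g + 1) + 1 := by
    have := half_le_cmid hg; positivity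
  have e : (cmid g : ℂ) ^ (2 * g + 1) + 1 = ((cmid g ^ (2 * g + 1) + 1 : ℝ) : ℂ) := by push_cast; ring
  rw [e, csqrt_ofReal hm]
  rw [e] at hsq
  have hsq' : (shalf g * r) ^ 2 = cmid g ^ (2 * g + 1) + 1 := by exact_mod_cast hsq
  have hpos : 0 < shalf g * r := mul_pos (shalf_pos hg) hr
  rw [← hsq', Real.sqrt_sq hpos.le]
  push_cast; ring

/-- **The lower sheet over the first half-turn**: `σ sin θ · bS (jX e^{iθ}) = √(jX^{2g+1} + 1)` for
`θ ∈ [0, π]` (continuous roots agreeing at `π/2`, non-vanishing on `(0, π)`). [cite: Milnor1968, §9] -/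
theorem sheet_eq_csqrt (hg : 1 ≤ g) {θ : ℝ} (hθ : θ ∈ Icc 0 π) :
    ((shalf g * Real.sin θ : ℝ) : ℂ) * bS g (jX g (Complex.exp (θ * I))) =
      csqrt (jX g (Complex.exp (θ * I)) ^ (2 * g + 1) + 1) := by
  -- on the open interval
  have hopen : EqOn (fun θ : ℝ => ((shalf g * Real.sin θ : ℝ) : ℂ) * bS g (jX g (Complex.exp (θ * I))))
      (fun θ : ℝ => csqrt (jX g (Complex.exp (θ * I)) ^ (2 * g + 1) + 1)) (Ioo 0 π) := by
    refine isPreconnected_Ioo.eq_of_sq_eq (continuous_sheet_exp hg).continuousOn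
      (continuous_csqrt_exp g).continuousOn (fun θ' _ => ?_) (fun {θ'} hθ' => ?_)
      (y := π / 2) ⟨by positivity, by linarith [Real.pi_pos]⟩ (sheet_eq_csqrt_half hg)
    · show (fun θ : ℝ => ((shalf g * Real.sin θ : ℝ) : ℂ) * bS g (jX g (Complex.exp (θ * I)))) θ' ^ 2 =
        (fun θ : ℝ => csqrt (jX g (Complex.exp (θ * I)) ^ (2 * g + 1) + 1)) θ' ^ 2
      dsimp only
      rw [sheet_sq_exp hg, csqrt_sq]
    · exact csqrt_ne_zero (pow_add_one_ne_zero_of_norm_lt (norm_jX_exp_lt hg hθ'))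
  rcases eq_or_lt_of_le hθ.1 with h0 | h0
  · -- `θ = 0`: the branch point `η`
    subst h0
    have hx : jX g (Complex.exp ((0 : ℝ) * I)) = branchPt g 0 := by
      rw [jX_exp, Real.cos_zero, mul_one, branchPt_zero_eq]
    rw [hx, branchPt_pow, Real.sin_zero]; simp
  rcases eq_or_lt_of_le hθ.2 with h1 | h1
  · -- `θ = π`: the branch point `η̄ = ζ_{2g}`
    subst h1
    have hx : jX g (Complex.exp ((π : ℝ) * I)) = branchPt g (2 * g) := by
      rw [show 2 * g = 2 * g - 0 from rfl, branchPt_two_mul_sub (Nat.zero_le _), branchPt_zero_eq, jX_exp,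
        Real.cos_pi, map_add, map_mul, Complex.conj_ofReal, Complex.conj_ofReal, Complex.conj_I]
      push_cast; ring
    rw [hx, branchPt_pow, Real.sin_pi]; simp
  exact hopen ⟨h0, h1⟩

/-- **Sub-goal `helper_jY_exp_eq`** (Y4-3b of the model chain (R2) for node N1a of NF4): on the first
half-turn of the unit circle the Joukowski sheet is the LOWER sheet of the chain loops,
`jY (e^{iθ}) = −√(jX(e^{iθ})^{2g+1} + 1)` for `θ ∈ [0, π]`, `g ≥ 1`. [cite: Milnor1968, §9] -/
theorem helper_jY_exp_eq : ∀ (g : ℕ) (_hg : 1 ≤ g) (θ : ℝ), θ ∈ Set.Icc 0 Real.pi → Summit.SmoothPoincare4.SmoothPoincare4.Theorems.AcyclicBisectionExists.ModpBraidOrbits.jY g (Complex.exp (θ * Complex.I)) = -Literature.Topology.FourManifolds.LefschetzBase.csqrt (Summit.SmoothPoincare4.SmoothPoincare4.Theorems.AcyclicBisectionExists.ModpBraidOrbits.jX g (Complex.exp (θ * Complex.I)) ^ (2 * g + 1) + 1) := by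
  intro g hg θ hθ
  rw [jY_exp, neg_mul, sheet_eq_csqrt hg hθ]

/-- The lower sheet over `[0, π]`. [folklore] -/
theorem jY_exp_of_mem_Icc (hg : 1 ≤ g) {θ : ℝ} (hθ : θ ∈ Icc 0 π) :
    jY g (Complex.exp (θ * I)) = -csqrt (jX g (Complex.exp (θ * I)) ^ (2 * g + 1) + 1) :=
  helper_jY_exp_eq g hg θ hθ

/-- **The upper sheet over the second half-turn**: `jY (e^{iθ}) = +√(…)` for `θ ∈ [π, 2π]`
(`e^{iθ} = (e^{i(2π−θ)})⁻¹` and the sheet involution `jY t⁻¹ = −jY t`). [folklore] -/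
theorem jY_exp_of_mem_Icc' (hg : 1 ≤ g) {θ : ℝ} (hθ : θ ∈ Icc π (2 * π)) :
    jY g (Complex.exp (θ * I)) = csqrt (jX g (Complex.exp (θ * I)) ^ (2 * g + 1) + 1) := by
  have hθ' : 2 * π - θ ∈ Icc 0 π := ⟨by linarith [hθ.2], by linarith [hθ.1]⟩
  have he : Complex.exp (θ * I) = (Complex.exp (((2 * π - θ : ℝ) : ℂ) * I))⁻¹ := by
    rw [← Complex.exp_neg, show -(((2 * π - θ : ℝ) : ℂ) * I) = (θ : ℂ) * I + (-1 : ℤ) * (2 * π * I) by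
      push_cast; ring, Complex.exp_add, Complex.exp_int_mul_two_pi_mul_I, mul_one]
  rw [he, jY_inv, jX_inv, jY_exp_of_mem_Icc hg hθ', neg_neg]

/-- The chord point at a shifted phase: `jX (e^{i(2πu + π)}) = m − iσ cos (2πu)`. [folklore] -/
theorem jX_exp_shift (g : ℕ) (u : ℝ) :
    jX g (Complex.exp (((2 * π * u + π : ℝ) : ℂ) * I)) = (cmid g : ℂ) - ((shalf g * Real.cos (2 * π * u) : ℝ) : ℂ) * I := by
  rw [jX_exp, Real.cos_add_pi]; push_cast; ring

/-- **The shifted unit circle in sheet form**: for `u ∈ [0, 1]`,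
`jY (e^{i(2πu+π)}) = halfsign · √(…)` with `+` on `[0, 1/2]` and `−` on `(1/2, 1]`. [folklore] -/
theorem jY_exp_shift (hg : 1 ≤ g) {u : ℝ} (hu : u ∈ Icc (0 : ℝ) 1) :
    jY g (Complex.exp (((2 * π * u + π : ℝ) : ℂ) * I)) =
      (if u ≤ 1 / 2 then 1 else -1) *
        csqrt (jX g (Complex.exp (((2 * π * u + π : ℝ) : ℂ) * I)) ^ (2 * g + 1) + 1) := by
  split_ifs with h
  · rw [one_mul]
    exact jY_exp_of_mem_Icc' hg ⟨by nlinarith [Real.pi_pos, hu.1], by nlinarith [Real.pi_pos]⟩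
  · rw [neg_one_mul]
    have hper : Complex.exp (((2 * π * u + π : ℝ) : ℂ) * I) = Complex.exp (((2 * π * u - π : ℝ) : ℂ) * I) := by
      rw [show ((2 * π * u + π : ℝ) : ℂ) * I = ((2 * π * u - π : ℝ) : ℂ) * I + 2 * π * I by push_cast; ring,
        Complex.exp_add, Complex.exp_two_pi_mul_I, mul_one]
    rw [hper]
    exact jY_exp_of_mem_Icc hg ⟨by nlinarith [Real.pi_pos, not_le.1 h], by nlinarith [Real.pi_pos, hu.2]⟩

/-! ## §3 The imaginary axis of the `t`-plane: real points, lower sheet -/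

/-- `jY (iρ) = −√(jX(iρ)^{2g+1} + 1)` for `1 ≤ ρ ≤ 1 + 1/(2g+1)`: on the imaginary axis the
Joukowski sheet is the lower sheet of the principal root (everything is real there). [folklore] -/
theorem jY_I_mul_eq_neg_csqrt (hg : 1 ≤ g) {ρ : ℝ} (h1 : 1 ≤ ρ) (h2 : ρ ≤ 1 + 1 / (2 * g + 1)) :
    jY g (I * ρ) = -csqrt (jX g (I * ρ) ^ (2 * g + 1) + 1) := by
  set ξ : ℝ := cmid g - shalf g * ((ρ - ρ⁻¹) / 2) with hξ
  have hx : jX g (I * ρ) = (ξ : ℂ) := jX_I_mul g ρ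
  have hn : ‖I * (ρ : ℂ)‖ = ρ := by
    rw [norm_mul, Complex.norm_I, one_mul, Complex.norm_real, Real.norm_eq_abs, abs_of_pos (by linarith)]
  have hstrip : Real.cos (branchAngle g 1) < ξ := by
    have := strip_of_norm_le hg (t := I * ρ) (by rw [hn]; exact h1) (by rw [hn]; exact h2)
    rwa [hx, Complex.ofReal_re] at this
  obtain ⟨r, hr, hbS⟩ := bS_ofReal hstrip
  have hy : jY g (I * ρ) = -((shalf g * ((ρ + ρ⁻¹) / 2) * r : ℝ) : ℂ) := by
    rw [jY_I_mul, hx, hbS]; push_cast; ring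
  have hsq : (shalf g * ((ρ + ρ⁻¹) / 2) * r) ^ 2 = ξ ^ (2 * g + 1) + 1 := by
    have h := jY_sq hg (t := I * ρ) (by rw [← norm_pos_iff, hn]; linarith)
    rw [hy, hx, neg_sq] at h
    exact_mod_cast h
  have hpos : 0 < shalf g * ((ρ + ρ⁻¹) / 2) * r := by
    have : 0 < ρ⁻¹ := by positivity
    exact mul_pos (mul_pos (shalf_pos hg) (by linarith)) hr
  have e : jX g (I * ρ) ^ (2 * g + 1) + 1 = ((ξ ^ (2 * g + 1) + 1 : ℝ) : ℂ) := by rw [hx]; push_cast; ring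
  rw [e, csqrt_ofReal (by rw [← hsq]; positivity), ← hsq, Real.sqrt_sq hpos.le, hy]

/-- The real point `jX (iρ)` lies in `(0, m] ⊂` the closed unit disc for `1 ≤ ρ ≤ 1 + 1/12`.
[folklore] -/
theorem norm_jX_I_mul_le (hg : 1 ≤ g) {ρ : ℝ} (h1 : 1 ≤ ρ) (h2 : ρ ≤ 1 + 1 / 12) : ‖jX g (I * ρ)‖ ≤ 1 := by
  rw [jX_I_mul, Complex.norm_real, Real.norm_eq_abs]
  have hm := half_le_cmid hg
  have hm1 : cmid g ≤ 1 := Real.cos_le_one _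
  have hs := shalf_pos hg
  have hs1 : shalf g ≤ 1 := Real.sin_le_one _
  have hb0 : 0 ≤ (ρ - ρ⁻¹) / 2 := by
    have : ρ⁻¹ ≤ 1 := inv_le_one_of_one_le₀ h1
    linarith
  have hb1 : (ρ - ρ⁻¹) / 2 ≤ 1 / 12 := by
    have hρ : (0 : ℝ) < ρ := by linarith
    have key : (ρ - ρ⁻¹) / 2 - (ρ - 1) = -((ρ - 1) ^ 2) / (2 * ρ) := by field_simp; ring
    have : -((ρ - 1) ^ 2) / (2 * ρ) ≤ 0 := div_nonpos_of_nonpos_of_nonneg (neg_nonpos.2 (sq_nonneg _)) (by linarith)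
    linarith
  rw [abs_le]
  constructor <;> nlinarith

end Summit.SmoothPoincare4.SmoothPoincare4.Theorems.AcyclicBisectionExists.ModpBraidOrbits

end
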